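import Literature.MathematicalPhysics.QuantumFieldTheory.QCDTransferMatrix
import Literature.MathematicalPhysics.QuantumLattice.FermionGammaFunctorTrace

/-!
# `fockLift = Gamma`, and `Γ` of a positive definite one-particle matrix is positive definite
(helper for crux stmt-QuantumFields-9737, line `Sketch` — stubs `fockLift_eq_Gamma`,
`fockLift_posDef` of the Lüscher-positivity package for the fermionic transfer operator
`T̂_F(U) = (det A)² · Γ(M_F(U))` of lattice QCD with Wilson quarks)

The tree carries two copies of the second-quantisation (matrix-of-minors) functor on the
fermionic Fock space `Fock ι = Finset ι → ℂ`:
`Literature.MathematicalPhysics.QuantumFieldTheory.fockLift` (`QCDTransferMatrix`, the vocabulary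
of the QCD transfer matrix) and `Literature.MathematicalPhysics.QuantumLattice.Gamma`
(`FermionGammaFunctor`, where functoriality `Γ(gh) = Γ(g)Γ(h)`, `Γ(1) = 1`, `Γ(gᴴ) = Γ(g)ᴴ`,
`Γ(g)Γ(g⁻¹) = 1` and `Tr Γ(g) = det(1 + g)` are proved). Both are
`⟨s|Γ(X)|t⟩ = det X[s,t]` (increasing enumerations; `0` if `#s ≠ #t`), the `dif` hypothesis being
stated as `#t = #s` in the first and `#s = #t` in the second; `fockLift_eq_Gamma` identifies them,
and the sub-namespace `FockLiftPosDef` transports the functor calculus to `fockLift`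
(`fockLift_one`, `fockLift_mul`, `fockLift_conjTranspose`, `fockLift_mul_inv`, `fockLift_inv_mul`,
`isUnit_fockLift`, `trace_fockLift`, `fockLift_posSemidef`).

`fockLift_posDef`: for `M` positive definite write `M = yᴴy` (the C⋆-order on matrices,
`CStarAlgebra.nonneg_iff_eq_star_mul_self`), so `Γ(M) = Γ(y)ᴴ Γ(y)` is positive semidefinite, and
`Γ(M)` is a unit (`Γ(M) Γ(M⁻¹) = Γ(1) = 1`), hence positive definite
(`Matrix.PosSemidef.posDef_iff_isUnit`). This is the positivity of `Γ` of a positive operator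
used in Lüscher's construction of the transfer matrix for Wilson fermions
([cite: Luscher1977, §3]; [cite: Smit2023, §6.5 (6.91)]); as a statement about compound matrices
it is classical (the `k`-th compound of a positive definite matrix is positive definite).
Pure theorem file (no definitions).
-/

namespace Summit.QuantumFields.QCD.Cruxes.StableActionBridge.Sketch

open scoped ComplexOrder MatrixOrder Matrix
open Literature.MathematicalPhysics.QuantumFieldTheory Literature.MathematicalPhysics.QuantumLattice

namespace FockLiftPosDef

/-- `fockLift X = Gamma X` for an index type in any universe (no finiteness needed): both sides
are the matrix of minors `⟨s|Γ(X)|t⟩ = det X[s,t]`, `0` off the particle-number diagonal.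
[folklore] -/
theorem fockLift_eq_Gamma' {ι : Type*} [LinearOrder ι] (X : Matrix ι ι ℂ) :
    fockLift X = Gamma X := by
  ext s t
  by_cases h : s.card = t.card
  · rw [Gamma_apply_of_card_eq X rfl h.symm, fockLift, Matrix.of_apply, dif_pos h.symm]
  · rw [Gamma_apply_of_card_ne X h, fockLift, Matrix.of_apply, dif_neg (Ne.symm h)]

end FockLiftPosDef

/-- **The two second-quantisation functors of the tree agree**: `fockLift X = Gamma X`
(`QCDTransferMatrix.fockLift` vs `FermionGammaFunctor.Gamma`; same minors, the cardinality
hypothesis of the `dif` stated the other way round). Registered sub-goal of crux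
stmt-QuantumFields-9737, line `Sketch`. [folklore] -/
theorem fockLift_eq_Gamma :
    ∀ (ι : Type) [LinearOrder ι] [Fintype ι] (X : Matrix ι ι ℂ), fockLift X = Gamma X :=
  fun _ _ _ X => FockLiftPosDef.fockLift_eq_Gamma' X

namespace FockLiftPosDef

section Adjoint

variable {ι : Type*} [LinearOrder ι]

/-- `Γ(Xᴴ) = Γ(X)ᴴ` for `fockLift` (minors of the conjugate transpose). [folklore] -/
theorem fockLift_conjTranspose (X : Matrix ι ι ℂ) : fockLift Xᴴ = (fockLift X)ᴴ := by
  rw [fockLift_eq_Gamma', fockLift_eq_Gamma', Gamma_conjTranspose]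

end Adjoint

variable {ι : Type*} [LinearOrder ι] [Fintype ι]

/-- `Γ(1) = 1` for `fockLift`. Dereziński–Gérard Prop. 3.23 (1). [folklore] -/
theorem fockLift_one : fockLift (1 : Matrix ι ι ℂ) = 1 := by
  rw [fockLift_eq_Gamma', Gamma_one]

/-- **Functoriality `Γ(XY) = Γ(X)Γ(Y)`** for `fockLift` (Cauchy–Binet for all minors at once).
Dereziński–Gérard Prop. 3.23 (1). [folklore] -/
theorem fockLift_mul (X Y : Matrix ι ι ℂ) : fockLift (X * Y) = fockLift X * fockLift Y := by
  rw [fockLift_eq_Gamma', fockLift_eq_Gamma', fockLift_eq_Gamma', Gamma_mul]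

/-- `Γ(X) Γ(X⁻¹) = 1` for `fockLift` and invertible `X`. [folklore] -/
theorem fockLift_mul_inv {X : Matrix ι ι ℂ} (hX : IsUnit X.det) :
    fockLift X * fockLift X⁻¹ = 1 := by
  rw [fockLift_eq_Gamma', fockLift_eq_Gamma', Gamma_mul_inv hX]

/-- `Γ(X⁻¹) Γ(X) = 1` for `fockLift` and invertible `X`. [folklore] -/
theorem fockLift_inv_mul {X : Matrix ι ι ℂ} (hX : IsUnit X.det) :
    fockLift X⁻¹ * fockLift X = 1 := by
  rw [fockLift_eq_Gamma', fockLift_eq_Gamma', Gamma_inv_mul hX]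

/-- `Γ(X)` is invertible when `X` is (with inverse `Γ(X⁻¹)`). [folklore] -/
theorem isUnit_fockLift {X : Matrix ι ι ℂ} (hX : IsUnit X.det) : IsUnit (fockLift X) :=
  ⟨⟨fockLift X, fockLift X⁻¹, fockLift_mul_inv hX, fockLift_inv_mul hX⟩, rfl⟩

/-- **`Tr Γ(X) = det(1 + X)`** for `fockLift` (the free-fermion partition function; from
`trace_Gamma`). [folklore] -/
theorem trace_fockLift (X : Matrix ι ι ℂ) : (fockLift X).trace = (1 + X).det := by
  rw [fockLift_eq_Gamma', trace_Gamma]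

/-- `Γ` of a positive SEMIdefinite matrix is positive semidefinite: `M = yᴴ y` gives
`Γ(M) = Γ(y)ᴴ Γ(y)`. [folklore] -/
theorem fockLift_posSemidef {M : Matrix ι ι ℂ} (hM : M.PosSemidef) : (fockLift M).PosSemidef := by
  obtain ⟨y, rfl⟩ := CStarAlgebra.nonneg_iff_eq_star_mul_self.mp hM.nonneg
  rw [Matrix.star_eq_conjTranspose, fockLift_mul, fockLift_conjTranspose]
  exact Matrix.posSemidef_conjTranspose_mul_self _

/-- `Γ` of a positive definite matrix is positive definite (universe-polymorphic form of the
registered `fockLift_posDef`): positive semidefinite by `fockLift_posSemidef` and a unit by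
`isUnit_fockLift`. [folklore] -/
theorem fockLift_posDef' {M : Matrix ι ι ℂ} (hM : M.PosDef) : (fockLift M).PosDef :=
  (fockLift_posSemidef hM.posSemidef).posDef_iff_isUnit.mpr
    (isUnit_fockLift ((Matrix.isUnit_iff_isUnit_det M).mp hM.isUnit))

end FockLiftPosDef

/-- **`Γ` of a positive definite one-particle matrix is positive definite** on the fermionic Fock
space: `M = yᴴy ⇒ Γ(M) = Γ(y)ᴴΓ(y) ≥ 0`, and `Γ(M)` is invertible (`Γ(M)Γ(M⁻¹) = Γ(1) = 1`), so
`Γ(M) > 0`. The fermionic half of Lüscher's positivity of the Wilson transfer matrix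
(Lüscher 1977 §3; Smit §6.5 (6.91)). Registered sub-goal of crux stmt-QuantumFields-9737,
line `Sketch`. [folklore] -/
theorem fockLift_posDef :
    ∀ (ι : Type) [LinearOrder ι] [Fintype ι] (M : Matrix ι ι ℂ), M.PosDef → (fockLift M).PosDef :=
  fun _ _ _ _ hM => FockLiftPosDef.fockLift_posDef' hM

end Summit.QuantumFields.QCD.Cruxes.StableActionBridge.Sketch
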